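import Summits.QuantumAdvantage.QuantumAdvantage.Theorems.CubicForrelationNearExactIsExactAmmCeilingX
import Summits.QuantumAdvantage.QuantumAdvantage.Theorems.NearExactIsExact.Negative.CornerFlatPluecker

/-!
# `NearExactIsExact` (stmt-QuantumAdvantage-14043), negative side — third derivatives of a cubic along a moving
# 3-frame are linear in its Plücker 3-vector (the building block of the imbalance-4 ISOTROPY LEMMA)

Negative-side support (disprover lane, unit `b2b-cforr-disprove-g33`, 2026-08-23) for the crux
`Summit.QuantumAdvantage.QuantumAdvantage.Theses.CubicForrelation.NearExactIsExact`.
HONEST FRAMING: VALUE = THEOREM — NOT summit progress.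

**Context: the imbalance-4 corner-flat habitat (`AMM₂`, HOME `DISPROOF.md` §42).**  The next level of the
Maiorana–McFarland filtration after the landed `stub_ammCeiling` (imbalance `2`, plane fibres): cubic
`g(y₁‖y₂)` with `(-1)^g = (-1)^{y₁·φ(y₂)}(-1)^{h(y₂)}`, `φ : 𝔽₂^{a+4} → 𝔽₂^a` quadratic and `16`-to-`1` with 4-FLAT
fibres `b(x₁) + V(x₁)`, and a cubic partner `f(x₁‖x₂) = q_{B(x₁)}(x₂) ⊕ ℓ(x₁)·x₂ ⊕ f₀(x₁)` whose `x₂`-slices are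
quadratic of rank `4` with support space `V(x₁)` (polar matrix `B(x₁)`, affine in `x₁` by cubicity).  On paper
(loc. cit., machine-checked on `360` random members at `a = 2, 3, 4`):
`Φ(f,g) = 1 − #{mismatched corners}/2^{a+3}`, a corner `c` of the fibre over `x₁` being mismatched when `h(c)`
differs from the dual rank-4 quadratic pattern of the slice; a mismatch-free fibre needs the cubic part `t` of
`h` to VANISH on `V(x₁)` (`t(V,V,V) = 0`, "isotropic fibre"), a non-isotropic fibre carries `≥ 2` mismatches, and
the non-isotropy locus is cut out by the vector `t ⌟ γ₂(B(x₁))` (contraction of `t` with the Pfaffian 4-vector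
of `B`), whose coordinates have `x₁`-degree `≤ 2` — so ONE non-isotropic fibre forces `≥ 2^{a-2}` of them and
`Φ ≤ 1 − 2·2^{a-2}/2^{a+3} = 15/16` (ISOTROPY LEMMA; the fraction `2^{a-2}/2^a` is attained at `a = 4`).

**This file** proves the frame form of the mechanism, for any degree bound `D`: for cubic `h : 𝔽₂^m → 𝔽₂` and
ANY maps `b s t r : 𝔽₂^a → 𝔽₂^m`, the third derivative along the moving frame,
`x ↦ ⊕_{ε ∈ 𝔽₂³} h(b(x) ⊕ ε₁s(x) ⊕ ε₂t(x) ⊕ ε₃r(x))`, has degree `≤ D` as soon as the `3 × 3` minors of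
`(s,t,r)` (the Plücker coordinates of the 3-vector `s ∧ t ∧ r`) have degree `≤ D` (`cft_flat3_deg`) — the base
point `b` is irrelevant and no degree bound on `s, t, r` themselves is needed; hence one non-isotropic frame
position forces `≥ 2^{a-D}` of them (`cft_noniso_many`, Reed–Muller minimum weight `stub_rmWeight`); the
sharp case `D = 2` is the Pfaffian form `cft_minor_deg_of_pfaffian` / `cft_noniso_many_pfaffian` (minors =
contractions of `γ₂(B)`, `B` affine).  Proof:
monomial expansion of `h` (`cfp_eval_ind`), additivity (`isDegLeFun_sum`), and for a monomial `y_S`, `|S| ≤ 3`,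
the eight-corner sum is `0` for `|S| ≤ 2` and the minor `det (s,t,r)_S` for `|S| = 3` (`cft_corner1/2/3`,
Boolean identities by `decide`).  Standard three axioms only.
-/

set_option linter.dupNamespace false -- D-0017: single-problem summit ⇒ `QuantumAdvantage.QuantumAdvantage` by design

noncomputable section

namespace Summit.QuantumAdvantage.QuantumAdvantage.Theorems.NearExactIsExact.Negative.CornerFlatThreeFlat

open Finset
open Literature.Computability.QuantumComplexity
open Literature.Computability.QuantumComplexity.BuzetChailloux (bxor)
open Summit.QuantumAdvantage.QuantumAdvantage.Theorems.CubicForrelation.NearExactIsExact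
open Summit.QuantumAdvantage.QuantumAdvantage.Theorems.NearExactIsExact.Negative.SkewProductCore (ind ind_and ind_xor
  decide_ind_eq_one isDegLeFun_sum)
open Summit.QuantumAdvantage.QuantumAdvantage.Theorems.NearExactIsExact.Negative.CornerFlatPluecker (cfp_eval_ind
  cfp_card_support_le)

variable {a m : ℕ}

/-! ### The eight-corner sum of a monomial -/

/-- One variable: the eight corners `b ⊕ ε₁s ⊕ ε₂t ⊕ ε₃r` sum to `0` coordinatewise. [folklore] -/
theorem cft_corner1 : ∀ bi si ti ri : Bool,
    ((bi ^^ (bi ^^ si) ^^ (bi ^^ ti) ^^ (bi ^^ (si ^^ ti))) ^^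
      ((bi ^^ ri) ^^ ((bi ^^ ri) ^^ si) ^^ ((bi ^^ ri) ^^ ti) ^^ ((bi ^^ ri) ^^ (si ^^ ti)))) = false := by
  decide

/-- Two variables: the eight-corner sum of `yᵢyⱼ` vanishes (a third derivative of a quadratic). [folklore] -/
theorem cft_corner2 : ∀ bi bj si sj ti tj ri rj : Bool,
    (((bi && bj) ^^ ((bi ^^ si) && (bj ^^ sj)) ^^ ((bi ^^ ti) && (bj ^^ tj)) ^^
        ((bi ^^ (si ^^ ti)) && (bj ^^ (sj ^^ tj)))) ^^
      (((bi ^^ ri) && (bj ^^ rj)) ^^ (((bi ^^ ri) ^^ si) && ((bj ^^ rj) ^^ sj)) ^^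
        (((bi ^^ ri) ^^ ti) && ((bj ^^ rj) ^^ tj)) ^^ (((bi ^^ ri) ^^ (si ^^ ti)) && ((bj ^^ rj) ^^ (sj ^^ tj))))) =
      false := by
  decide

/-- Three variables: the eight-corner sum of `yᵢyⱼy_k` is the minor `det (s,t,r)_{ijk}` — the third derivative
`D_sD_tD_r (yᵢyⱼy_k)`, independent of the base point `b` (a `2¹²`-case identity). [folklore] -/
theorem cft_corner3 : ∀ bi bj bk si sj sk ti tj tk ri rj rk : Bool,
    (((bi && (bj && bk)) ^^ ((bi ^^ si) && ((bj ^^ sj) && (bk ^^ sk))) ^^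
        ((bi ^^ ti) && ((bj ^^ tj) && (bk ^^ tk))) ^^
        ((bi ^^ (si ^^ ti)) && ((bj ^^ (sj ^^ tj)) && (bk ^^ (sk ^^ tk))))) ^^
      (((bi ^^ ri) && ((bj ^^ rj) && (bk ^^ rk))) ^^
        (((bi ^^ ri) ^^ si) && (((bj ^^ rj) ^^ sj) && ((bk ^^ rk) ^^ sk))) ^^
        (((bi ^^ ri) ^^ ti) && (((bj ^^ rj) ^^ tj) && ((bk ^^ rk) ^^ tk))) ^^
        (((bi ^^ ri) ^^ (si ^^ ti)) && (((bj ^^ rj) ^^ (sj ^^ tj)) && ((bk ^^ rk) ^^ (sk ^^ tk)))))) =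
      ((si && ((tj && rk) ^^ (tk && rj))) ^^ (sj && ((ti && rk) ^^ (tk && ri))) ^^
        (sk && ((ti && rj) ^^ (tj && ri)))) := by
  intro bi bj bk
  cases bi <;> cases bj <;> cases bk <;> decide

/-- The eight-corner sum `x ↦ Σ_{ε} Π_{i∈S} [(b ⊕ ε₁s ⊕ ε₂t ⊕ ε₃r)(x)ᵢ]` of a monomial `y_S`, `|S| ≤ 3`, has
degree `≤ D` as soon as the `3 × 3` minors of the frame `(s,t,r)` have degree `≤ D` (`cft_corner1/2/3`).
[folklore] -/
theorem cft_monomial_deg (S : Finset (Fin m)) (hS : S.card ≤ 3) {b s t r : (Fin a → Bool) → (Fin m → Bool)}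
    {D : ℕ} (hdet : ∀ i j k, i ≠ j → i ≠ k → j ≠ k → IsDegLeFun D (fun x =>
      (s x i && ((t x j && r x k) ^^ (t x k && r x j))) ^^ (s x j && ((t x i && r x k) ^^ (t x k && r x i))) ^^
        (s x k && ((t x i && r x j) ^^ (t x j && r x i))))) :
    IsDegLeFun D (fun x => decide ((((∏ i ∈ S, ind (b x i)) + (∏ i ∈ S, ind (bxor (b x) (s x) i)) +
        (∏ i ∈ S, ind (bxor (b x) (t x) i)) + ∏ i ∈ S, ind (bxor (b x) (bxor (s x) (t x)) i)) +
      ((∏ i ∈ S, ind (bxor (b x) (r x) i)) + (∏ i ∈ S, ind (bxor (bxor (b x) (r x)) (s x) i)) +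
        (∏ i ∈ S, ind (bxor (bxor (b x) (r x)) (t x) i)) +
        ∏ i ∈ S, ind (bxor (bxor (b x) (r x)) (bxor (s x) (t x)) i))) = 1)) := by
  have h1 : ∀ x i, bxor (b x) (s x) i = (b x i ^^ s x i) := fun _ _ => rfl
  have h2 : ∀ x i, bxor (b x) (t x) i = (b x i ^^ t x i) := fun _ _ => rfl
  have h3 : ∀ x i, bxor (b x) (bxor (s x) (t x)) i = (b x i ^^ (s x i ^^ t x i)) := fun _ _ => rfl
  have h4 : ∀ x i, bxor (b x) (r x) i = (b x i ^^ r x i) := fun _ _ => rfl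
  have h5 : ∀ x i, bxor (bxor (b x) (r x)) (s x) i = ((b x i ^^ r x i) ^^ s x i) := fun _ _ => rfl
  have h6 : ∀ x i, bxor (bxor (b x) (r x)) (t x) i = ((b x i ^^ r x i) ^^ t x i) := fun _ _ => rfl
  have h7 : ∀ x i, bxor (bxor (b x) (r x)) (bxor (s x) (t x)) i = ((b x i ^^ r x i) ^^ (s x i ^^ t x i)) :=
    fun _ _ => rfl
  simp only [h1, h2, h3, h4, h5, h6, h7]
  have hc : S.card = 0 ∨ S.card = 1 ∨ S.card = 2 ∨ S.card = 3 := by omega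
  rcases hc with hc | hc | hc | hc
  · rw [Finset.card_eq_zero] at hc
    subst hc
    refine rm_isDegLeFun_congr (isDegLeFun_const D false) fun x => ?_
    rw [prod_empty]
    rfl
  · obtain ⟨i, rfl⟩ := Finset.card_eq_one.mp hc
    refine rm_isDegLeFun_congr (isDegLeFun_const D false) fun x => ?_
    simp only [prod_singleton, ← ind_xor, decide_ind_eq_one]
    exact (cft_corner1 _ _ _ _).symm
  · obtain ⟨i, j, hij, rfl⟩ := Finset.card_eq_two.mp hc
    refine rm_isDegLeFun_congr (isDegLeFun_const D false) fun x => ?_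
    have hi : i ∉ ({j} : Finset (Fin m)) := by simpa using hij
    simp only [prod_insert hi, prod_singleton, ← ind_and, ← ind_xor, decide_ind_eq_one]
    exact (cft_corner2 _ _ _ _ _ _ _ _).symm
  · obtain ⟨i, j, k, hij, hik, hjk, rfl⟩ := Finset.card_eq_three.mp hc
    refine rm_isDegLeFun_congr (hdet i j k hij hik hjk) fun x => ?_
    have hi : i ∉ ({j, k} : Finset (Fin m)) := by simp [hij, hik]
    have hj : j ∉ ({k} : Finset (Fin m)) := by simpa using hjk
    simp only [prod_insert hi, prod_insert hj, prod_singleton, ← ind_and, ← ind_xor, decide_ind_eq_one]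
    exact (cft_corner3 _ _ _ _ _ _ _ _ _ _ _ _).symm

/-! ### Third derivatives along a moving 3-frame -/

/-- **Cubic third derivatives are linear in the Plücker 3-vector.**  Let `h : 𝔽₂^m → 𝔽₂` be cubic and
`b s t r : 𝔽₂^a → 𝔽₂^m` any maps such that every `3 × 3` minor of `(s,t,r)` has degree `≤ D` in `x`.  Then
`x ↦ ⊕_{ε∈𝔽₂³} h(b(x) ⊕ ε₁s(x) ⊕ ε₂t(x) ⊕ ε₃r(x)) = D_{s(x)}D_{t(x)}D_{r(x)} h` has degree `≤ D`; the base point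
`b` plays no role.  (With `t_{ijk}` the cubic coefficients of `h` the function is `Σ t_{ijk} det (s,t,r)_{ijk}(x)`.)
[folklore] -/
theorem cft_flat3_deg {h : (Fin m → Bool) → Bool} (hh : IsDegLeFun 3 h)
    {b s t r : (Fin a → Bool) → (Fin m → Bool)} {D : ℕ}
    (hdet : ∀ i j k, i ≠ j → i ≠ k → j ≠ k → IsDegLeFun D (fun x =>
      (s x i && ((t x j && r x k) ^^ (t x k && r x j))) ^^ (s x j && ((t x i && r x k) ^^ (t x k && r x i))) ^^
        (s x k && ((t x i && r x j) ^^ (t x j && r x i))))) :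
    IsDegLeFun D (fun x =>
      (h (b x) ^^ h (bxor (b x) (s x)) ^^ h (bxor (b x) (t x)) ^^ h (bxor (b x) (bxor (s x) (t x)))) ^^
        (h (bxor (b x) (r x)) ^^ h (bxor (bxor (b x) (r x)) (s x)) ^^ h (bxor (bxor (b x) (r x)) (t x)) ^^
          h (bxor (bxor (b x) (r x)) (bxor (s x) (t x))))) := by
  classical
  obtain ⟨p, hp3, hrep⟩ := hh
  have hev : ∀ y, h y = decide ((∑ d ∈ p.support, p.coeff d * ∏ i ∈ d.support, ind (y i)) = 1) := by
    intro y
    rw [hrep y, polyPhase_apply, cfp_eval_ind]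
  have e : ∀ x, ((h (b x) ^^ h (bxor (b x) (s x)) ^^ h (bxor (b x) (t x)) ^^ h (bxor (b x) (bxor (s x) (t x)))) ^^
        (h (bxor (b x) (r x)) ^^ h (bxor (bxor (b x) (r x)) (s x)) ^^ h (bxor (bxor (b x) (r x)) (t x)) ^^
          h (bxor (bxor (b x) (r x)) (bxor (s x) (t x))))) =
      decide ((∑ d ∈ p.support, p.coeff d * (((∏ i ∈ d.support, ind (b x i)) +
        (∏ i ∈ d.support, ind (bxor (b x) (s x) i)) + (∏ i ∈ d.support, ind (bxor (b x) (t x) i)) +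
        ∏ i ∈ d.support, ind (bxor (b x) (bxor (s x) (t x)) i)) +
        ((∏ i ∈ d.support, ind (bxor (b x) (r x) i)) + (∏ i ∈ d.support, ind (bxor (bxor (b x) (r x)) (s x) i)) +
        (∏ i ∈ d.support, ind (bxor (bxor (b x) (r x)) (t x) i)) +
        ∏ i ∈ d.support, ind (bxor (bxor (b x) (r x)) (bxor (s x) (t x)) i)))) = 1) := by
    intro x
    rw [hev, hev, hev, hev, hev, hev, hev, hev, ← zmod2_decide_add, ← zmod2_decide_add, ← zmod2_decide_add,
      ← zmod2_decide_add, ← zmod2_decide_add, ← zmod2_decide_add, ← zmod2_decide_add]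
    simp only [mul_add, sum_add_distrib]
  refine rm_isDegLeFun_congr ?_ fun x => (e x).symm
  refine isDegLeFun_sum (fun d x => p.coeff d * (((∏ i ∈ d.support, ind (b x i)) +
        (∏ i ∈ d.support, ind (bxor (b x) (s x) i)) + (∏ i ∈ d.support, ind (bxor (b x) (t x) i)) +
        ∏ i ∈ d.support, ind (bxor (b x) (bxor (s x) (t x)) i)) +
        ((∏ i ∈ d.support, ind (bxor (b x) (r x) i)) + (∏ i ∈ d.support, ind (bxor (bxor (b x) (r x)) (s x) i)) +
        (∏ i ∈ d.support, ind (bxor (bxor (b x) (r x)) (t x) i)) +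
        ∏ i ∈ d.support, ind (bxor (bxor (b x) (r x)) (bxor (s x) (t x)) i)))) p.support fun d hd => ?_
  exact rm_isDegLeFun_congr
    (acq_deg_band (isDegLeFun_const 0 (decide (p.coeff d = 1)))
      (cft_monomial_deg d.support (cfp_card_support_le hp3 hd) hdet) (by norm_num))
    fun x => (zmod2_decide_mul _ _).symm

/-- **One non-isotropic frame position forces `≥ 2^{a-D}` of them.**  Under the hypotheses of `cft_flat3_deg`,
if the third derivative `D_{s(x)}D_{t(x)}D_{r(x)} h` is `1` at one point then it is `1` on at least `2^{a-D}`
points (Reed–Muller minimum weight, `stub_rmWeight`).  In the imbalance-4 corner-flat habitat each such point is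
a fibre with `≥ 2` mismatched corners, so with `D = 2` (Pfaffian form, HOME `DISPROOF.md` §42) `Φ ≤ 15/16`.
[folklore] -/
theorem cft_noniso_many {h : (Fin m → Bool) → Bool} (hh : IsDegLeFun 3 h)
    {b s t r : (Fin a → Bool) → (Fin m → Bool)} {D : ℕ}
    (hdet : ∀ i j k, i ≠ j → i ≠ k → j ≠ k → IsDegLeFun D (fun x =>
      (s x i && ((t x j && r x k) ^^ (t x k && r x j))) ^^ (s x j && ((t x i && r x k) ^^ (t x k && r x i))) ^^
        (s x k && ((t x i && r x j) ^^ (t x j && r x i)))))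
    (hone : ∃ x₀, ((h (b x₀) ^^ h (bxor (b x₀) (s x₀)) ^^ h (bxor (b x₀) (t x₀)) ^^
        h (bxor (b x₀) (bxor (s x₀) (t x₀)))) ^^
      (h (bxor (b x₀) (r x₀)) ^^ h (bxor (bxor (b x₀) (r x₀)) (s x₀)) ^^ h (bxor (bxor (b x₀) (r x₀)) (t x₀)) ^^
        h (bxor (bxor (b x₀) (r x₀)) (bxor (s x₀) (t x₀))))) = true) :
    2 ^ a ≤ 2 ^ D * (univ.filter fun x : Fin a → Bool =>
      ((h (b x) ^^ h (bxor (b x) (s x)) ^^ h (bxor (b x) (t x)) ^^ h (bxor (b x) (bxor (s x) (t x)))) ^^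
        (h (bxor (b x) (r x)) ^^ h (bxor (bxor (b x) (r x)) (s x)) ^^ h (bxor (bxor (b x) (r x)) (t x)) ^^
          h (bxor (bxor (b x) (r x)) (bxor (s x) (t x))))) = true).card :=
  stub_rmWeight stub_derivDegree a D _ (cft_flat3_deg hh hdet) hone

/-! ### The Pfaffian (degree-2) form used by the isotropy lemma -/

/-- **Pfaffian minors.**  If `B(x)` is an affine family of matrices and the `3 × 3` minors of the frame
`(s,t,r)(x)` are the contractions `B_{ij}B_{kl} ⊕ B_{ik}B_{jl} ⊕ B_{il}B_{jk}` of the Pfaffian 4-vector `γ₂(B(x))`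
with a fixed coordinate `l` — which is the case for ANY pointwise basis `(s,t,r)(x)` of `V(x) ∩ ker e_l^*` when
`B(x)` is alternating of rank `4` with row space `V(x)` (over `𝔽₂` all bases of a subspace have the same Plücker
coordinates; HOME `DISPROOF.md` §42) — then these minors have degree `≤ 2`. [folklore] -/
theorem cft_minor_deg_of_pfaffian {B : (Fin a → Bool) → Fin m → Fin m → Bool}
    (hB : ∀ i j, IsDegLeFun 1 (fun x => B x i j)) {s t r : (Fin a → Bool) → (Fin m → Bool)} (l : Fin m)
    (hmin : ∀ x i j k, ((s x i && ((t x j && r x k) ^^ (t x k && r x j))) ^^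
        (s x j && ((t x i && r x k) ^^ (t x k && r x i))) ^^ (s x k && ((t x i && r x j) ^^ (t x j && r x i)))) =
      ((B x i j && B x k l) ^^ (B x i k && B x j l) ^^ (B x i l && B x j k))) :
    ∀ i j k, i ≠ j → i ≠ k → j ≠ k → IsDegLeFun 2 (fun x =>
      (s x i && ((t x j && r x k) ^^ (t x k && r x j))) ^^ (s x j && ((t x i && r x k) ^^ (t x k && r x i))) ^^
        (s x k && ((t x i && r x j) ^^ (t x j && r x i)))) :=
  fun i j k _ _ _ => rm_isDegLeFun_congr
    (fc_deg_bxor (fc_deg_bxor (acq_deg_band (hB i j) (hB k l) (by norm_num))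
      (acq_deg_band (hB i k) (hB j l) (by norm_num))) (acq_deg_band (hB i l) (hB j k) (by norm_num)))
    fun x => (hmin x i j k).symm

/-- **Isotropy count, Pfaffian form (`D = 2`).**  For cubic `h`, an affine matrix family `B` and a frame
`(s,t,r)` whose minors are the `l`-contractions of `γ₂(B)` (`cft_minor_deg_of_pfaffian`), one point where
`D_sD_tD_r h = 1` forces at least `2^{a-2}` such points.  In the imbalance-4 corner-flat habitat (`B(x₁)` the
polar matrix of the cubic partner's slice, `(s,t,r)(x₁)` a basis of `V(x₁) ∩ ker e_l^*`), `D_sD_tD_r h (x₁)` is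
the `l`-th coordinate of `t ⌟ γ₂(B(x₁))`, nonzero for some `l` exactly when the fibre over `x₁` is not
`t`-isotropic; each such fibre has `≥ 2` mismatched corners, so `Φ ≤ 1 − 2·2^{a-2}/2^{a+3} = 15/16`
(HOME `DISPROOF.md` §42). [folklore] -/
theorem cft_noniso_many_pfaffian {h : (Fin m → Bool) → Bool} (hh : IsDegLeFun 3 h)
    {B : (Fin a → Bool) → Fin m → Fin m → Bool} (hB : ∀ i j, IsDegLeFun 1 (fun x => B x i j))
    {b s t r : (Fin a → Bool) → (Fin m → Bool)} (l : Fin m)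
    (hmin : ∀ x i j k, ((s x i && ((t x j && r x k) ^^ (t x k && r x j))) ^^
        (s x j && ((t x i && r x k) ^^ (t x k && r x i))) ^^ (s x k && ((t x i && r x j) ^^ (t x j && r x i)))) =
      ((B x i j && B x k l) ^^ (B x i k && B x j l) ^^ (B x i l && B x j k)))
    (hone : ∃ x₀, ((h (b x₀) ^^ h (bxor (b x₀) (s x₀)) ^^ h (bxor (b x₀) (t x₀)) ^^
        h (bxor (b x₀) (bxor (s x₀) (t x₀)))) ^^
      (h (bxor (b x₀) (r x₀)) ^^ h (bxor (bxor (b x₀) (r x₀)) (s x₀)) ^^ h (bxor (bxor (b x₀) (r x₀)) (t x₀)) ^^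
        h (bxor (bxor (b x₀) (r x₀)) (bxor (s x₀) (t x₀))))) = true) :
    2 ^ a ≤ 2 ^ 2 * (univ.filter fun x : Fin a → Bool =>
      ((h (b x) ^^ h (bxor (b x) (s x)) ^^ h (bxor (b x) (t x)) ^^ h (bxor (b x) (bxor (s x) (t x)))) ^^
        (h (bxor (b x) (r x)) ^^ h (bxor (bxor (b x) (r x)) (s x)) ^^ h (bxor (bxor (b x) (r x)) (t x)) ^^
          h (bxor (bxor (b x) (r x)) (bxor (s x) (t x))))) = true).card :=
  cft_noniso_many hh (cft_minor_deg_of_pfaffian hB l hmin) hone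

end Summit.QuantumAdvantage.QuantumAdvantage.Theorems.NearExactIsExact.Negative.CornerFlatThreeFlat

end
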